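import Literature.NumberTheory.Automorphic.HaarIntegralClosedCompactCcGeneral
import Literature.MeasureTheory.Radon.DirectedLowerSemicontinuous
import HarnessLib

/-!
# Haar integral over `G = H K`: slice measures and the set-level identity (Radon case)

Topic `NumberTheory/Automorphic`; namespace `Literature.NumberTheory.Automorphic.HaarHK`. The
measure-level half of the proof of Deitmar–Echterhoff, *Principles of Harmonic Analysis* (2014),
Prop. 1.5.6 in the book's generality — an arbitrary locally compact Hausdorff group `G = HK`
(`H` closed, `K` compact) with **regular** (outer Radon) Haar measures, *no countability assumed*:

* `lowerSemicontinuous_measure_mul_preimage`, `measurable_measure_mul_preimage`: for a regular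
  finite measure `μ_K` on `K`, the slice function `h ↦ μ_K {k : h k ∈ A}` on `H` is lower
  semicontinuous for `A` open and Borel measurable for `A` Borel (π-λ from the open case) — note
  that `(h, k) ↦ h k` need not be measurable for the product σ-algebra without second countability,
  so neither Fubini nor product measures are available;
* given the constant `C` of the `C_c` identity `∫_G f dμ_G = C ∫_H ∫_K f(hk)`
  (`HaarIntegralClosedCompactCcGeneral.lean`), the identity `∫⁻_H μ_K{k : hk ∈ A} dμ_H = C⁻¹ μ_G(A)`
  is proved for `A` open (upper bound = τ-smoothness of `μ_H`,
  `Literature.MeasureTheory.Radon.lintegral_le_iSup_lintegral_of_directed_of_lowerSemicontinuous`,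
  applied to the directed family `h ↦ ∫_K f(hk) dμ_K`, `f ∈ C_c(G)`, `0 ≤ f ≤ 1_U`; lower bound =
  inner regularity of `μ_G` + Urysohn), then for `A` compact and for Borel `A` of finite
  `μ_G`-measure (`lintegral_measure_mul_preimage_of_ne_top`,
  `measure_eq_mul_lintegral_measure_mul_preimage`).

The `L¹` statement is assembled in `HaarIntegralClosedCompactRadon.lean`.

## References

* A. Deitmar, S. Echterhoff, *Principles of Harmonic Analysis*, 2nd ed., Universitext, Springer
  (2014), §1.5, Prop. 1.5.6 (p. 21); Lemma B.3.2. [DeitmarEchterhoff2014]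
-/

noncomputable section

open MeasureTheory Measure Set Topology CompactlySupported Literature.MeasureTheory.Radon
open scoped ENNReal NNReal Pointwise

namespace Literature.NumberTheory.Automorphic.HaarHK

section Slices

variable {G : Type*} [Group G] [TopologicalSpace G] [IsTopologicalGroup G] [MeasurableSpace G]
  [BorelSpace G] {H K : Subgroup G}

omit [MeasurableSpace G] [BorelSpace G] in
/-- Continuity (hence measurability) of `k ↦ h k : K → G`. [folklore] -/
lemma continuous_coe_mul_coe (h : H) : Continuous fun k : K => (h : G) * (k : G) :=
  continuous_const.mul continuous_subtype_val

omit [BorelSpace G] in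
/-- **Lower semicontinuity of the slice measure.** For a regular finite measure `μ_K` on `K` and an
open `U ⊆ G`, `h ↦ μ_K {k : h k ∈ U}` is lower semicontinuous on `H` (tube lemma
`compact_open_separated_mul_left` + inner regularity of `μ_K`). [folklore] -/
lemma lowerSemicontinuous_measure_mul_preimage (μK : Measure K) [μK.Regular] {U : Set G}
    (hU : IsOpen U) :
    LowerSemicontinuous fun h : H => μK ((fun k : K => (h : G) * k) ⁻¹' U) := by
  refine lowerSemicontinuous_iff_isOpen_preimage.mpr fun t => ?_
  rw [isOpen_iff_mem_nhds]
  intro h₀ ht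
  replace ht : t < μK ((fun k : K => (h₀ : G) * k) ⁻¹' U) := ht
  obtain ⟨L, hLV, hL, htL⟩ := (hU.preimage (continuous_coe_mul_coe h₀)).exists_lt_isCompact ht
  have hL' : IsCompact ((fun k : K => (h₀ : G) * k) '' L) := hL.image (continuous_coe_mul_coe h₀)
  have hL'U : (fun k : K => (h₀ : G) * k) '' L ⊆ U := image_subset_iff.mpr hLV
  obtain ⟨V, hV1, hVU⟩ := compact_open_separated_mul_left hL' hU hL'U
  have hW : {h : H | (h : G) * (h₀ : G)⁻¹ ∈ V} ∈ 𝓝 h₀ := by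
    have hc : Continuous fun h : H => (h : G) * (h₀ : G)⁻¹ :=
      continuous_subtype_val.mul continuous_const
    exact hc.continuousAt.preimage_mem_nhds (by simpa using hV1)
  filter_upwards [hW] with h hh
  show t < μK ((fun k : K => (h : G) * k) ⁻¹' U)
  refine htL.trans_le (measure_mono fun k hk => ?_)
  show (h : G) * k ∈ U
  have : (h : G) * k = ((h : G) * (h₀ : G)⁻¹) * ((h₀ : G) * k) := by group
  rw [this]
  exact hVU (Set.mul_mem_mul hh (mem_image_of_mem _ hk))

/-- **Measurability of the slice measure.** For a regular finite measure `μ_K` on `K` and a Borel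
set `A ⊆ G`, `h ↦ μ_K {k : h k ∈ A}` is Borel measurable on `H` — by the `π`-`λ` theorem from the
open case; note that `(h, k) ↦ h k` need not be measurable for the *product* σ-algebra when `G` is not
second countable, so Fubini-type measurability is not available here. [folklore] -/
lemma measurable_measure_mul_preimage (μK : Measure K) [IsFiniteMeasure μK] [μK.Regular]
    {A : Set G} (hA : MeasurableSet A) :
    Measurable fun h : H => μK ((fun k : K => (h : G) * k) ⁻¹' A) := by
  have hm : ∀ h : H, Measurable fun k : K => (h : G) * (k : G) := fun h =>
    (continuous_coe_mul_coe h).measurable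
  refine MeasurableSpace.induction_on_inter
    (C := fun A _ => Measurable fun h : H => μK ((fun k : K => (h : G) * k) ⁻¹' A))
    (BorelSpace.measurable_eq (α := G)) isPiSystem_isOpen ?_ ?_ ?_ ?_ A hA
  · simp
  · exact fun U hU => (lowerSemicontinuous_measure_mul_preimage μK hU).measurable
  · intro t ht hC
    have : (fun h : H => μK ((fun k : K => (h : G) * k) ⁻¹' tᶜ)) =
        fun h : H => μK univ - μK ((fun k : K => (h : G) * k) ⁻¹' t) := by
      funext h
      rw [preimage_compl, measure_compl ((hm h) ht) (measure_ne_top _ _)]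
    rw [this]
    exact measurable_const.sub hC
  · intro f hdisj hfm hC
    have : (fun h : H => μK ((fun k : K => (h : G) * k) ⁻¹' ⋃ i, f i)) =
        fun h : H => ∑' i, μK ((fun k : K => (h : G) * k) ⁻¹' f i) := by
      funext h
      rw [preimage_iUnion, measure_iUnion (fun i j hij => (hdisj hij).preimage _)
        (fun i => hm h (hfm i))]
    rw [this]
    simp_rw [ENNReal.tsum_eq_iSup_sum]
    exact .iSup fun s ↦ s.measurable_fun_sum fun i _ => hC i

end Slices

section OpenCompact

variable {G : Type*} [Group G] [TopologicalSpace G] [IsTopologicalGroup G] [MeasurableSpace G]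
  [BorelSpace G] [T2Space G] [LocallyCompactSpace G] {H K : Subgroup G}
  (hH : IsClosed (H : Set G)) (hK : IsCompact (K : Set G))
  (μG : Measure G) [IsHaarMeasure μG] [μG.Regular]
  (μH : Measure H) [IsHaarMeasure μH] [μH.Regular]
  (μK : Measure K) [IsHaarMeasure μK]
  {C : ℝ} (hC0 : 0 < C)
  (hC : ∀ f : G → ℝ, Continuous f → HasCompactSupport f →
    ∫ g, f g ∂μG = C * ∫ h : H, ∫ k : K, f ((h : G) * k) ∂μK ∂μH)

include hH hK in
omit [T2Space G] [LocallyCompactSpace G] [μG.Regular] [μH.Regular] in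
/-- For a nonnegative `f ∈ C_c(G)`, `∫_K f(hk) dμ_K` as a function of `h ∈ H` is continuous,
compactly supported, nonnegative, hence `∫⁻_H ofReal(∫_K f(hk)) = ofReal(∫_H ∫_K f(hk))`.
[folklore] -/
lemma lintegral_ofReal_integral_comp_mul {f : G → ℝ} (hf : Continuous f)
    (hcs : HasCompactSupport f) (h0 : ∀ x, 0 ≤ f x) :
    ∫⁻ h : H, ENNReal.ofReal (∫ k : K, f ((h : G) * k) ∂μK) ∂μH =
      ENNReal.ofReal (∫ h : H, ∫ k : K, f ((h : G) * k) ∂μK ∂μH) := by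
  haveI : CompactSpace K := isCompact_iff_compactSpace.mp hK
  have hF : Continuous fun h : H => ∫ k : K, f ((h : G) * k) ∂μK :=
    (continuous_integral_comp_mul_right μK hf).comp continuous_subtype_val
  have hFc : HasCompactSupport fun h : H => ∫ k : K, f ((h : G) * k) ∂μK :=
    (hasCompactSupport_integral_comp_mul_right μK hK hcs).comp_isClosedEmbedding
      hH.isClosedEmbedding_subtypeVal
  rw [ofReal_integral_eq_lintegral_ofReal (hF.integrable_of_hasCompactSupport hFc)
    (Filter.Eventually.of_forall fun h => integral_nonneg fun k => h0 _)]

include hH hK hC0 hC in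
omit [T2Space G] [LocallyCompactSpace G] [μG.Regular] [μH.Regular] in
/-- The `C_c` identity in `lintegral` form for nonnegative test functions:
`∫⁻_H ofReal(∫_K f(hk) dμ_K) dμ_H = C⁻¹ ∫⁻_G ofReal(f) dμ_G`. [folklore] -/
lemma lintegral_ofReal_integral_comp_mul_eq {f : G → ℝ} (hf : Continuous f)
    (hcs : HasCompactSupport f) (h0 : ∀ x, 0 ≤ f x) :
    ∫⁻ h : H, ENNReal.ofReal (∫ k : K, f ((h : G) * k) ∂μK) ∂μH =
      ENNReal.ofReal C⁻¹ * ∫⁻ g, ENNReal.ofReal (f g) ∂μG := by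
  rw [lintegral_ofReal_integral_comp_mul hH hK μH μK hf hcs h0,
    ← ofReal_integral_eq_lintegral_ofReal (hf.integrable_of_hasCompactSupport hcs)
      (Filter.Eventually.of_forall h0), ← ENNReal.ofReal_mul (inv_nonneg.mpr hC0.le), hC f hf hcs,
    ← mul_assoc, inv_mul_cancel₀ hC0.ne', one_mul]

omit [IsTopologicalGroup G] [BorelSpace G] [T2Space G] [LocallyCompactSpace G] in
/-- Pointwise comparison of a `[0,1]`-valued function supported in `U` with the indicator of `U`,
in `lintegral` form. [folklore] -/
lemma lintegral_ofReal_le_measure {X : Type*} [MeasurableSpace X] (μ : Measure X) {f : X → ℝ}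
    (h1 : ∀ x, f x ≤ 1) {U : Set X} (hU : MeasurableSet U) (hfU : Function.support f ⊆ U) :
    ∫⁻ x, ENNReal.ofReal (f x) ∂μ ≤ μ U := by
  calc ∫⁻ x, ENNReal.ofReal (f x) ∂μ ≤ ∫⁻ x, U.indicator 1 x ∂μ := by
        refine lintegral_mono fun x => ?_
        by_cases hx : x ∈ U
        · simpa [hx] using h1 x
        · have : f x = 0 := Function.notMem_support.mp fun h => hx (hfU h)
          simp [hx, this]
    _ = μ U := lintegral_indicator_one hU

include hK in
omit [T2Space G] [LocallyCompactSpace G] [μG.Regular] [μH.Regular] in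
/-- Pointwise bound: for `f ≤ 1` supported in `U`, `ofReal (∫_K f(hk) dμ_K) ≤ μ_K {k : hk ∈ U}`.
[folklore] -/
lemma ofReal_integral_comp_mul_le {f : G → ℝ} (hf : Continuous f) (h0 : ∀ x, 0 ≤ f x)
    (h1 : ∀ x, f x ≤ 1) {U : Set G} (hU : IsOpen U) (hfU : Function.support f ⊆ U) (h : H) :
    ENNReal.ofReal (∫ k : K, f ((h : G) * k) ∂μK) ≤ μK ((fun k : K => (h : G) * k) ⁻¹' U) := by
  haveI : CompactSpace K := isCompact_iff_compactSpace.mp hK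
  rw [ofReal_integral_eq_lintegral_ofReal
    (integrable_of_continuous_of_compactSpace (f := fun k : K => f ((h : G) * k))
      (hf.comp (continuous_coe_mul_coe h)))
    (Filter.Eventually.of_forall fun k => h0 _)]
  exact lintegral_ofReal_le_measure μK (fun k => h1 _) (hU.measurableSet.preimage
    (continuous_coe_mul_coe h).measurable) (fun k hk => hfU hk)

include hK in
omit [LocallyCompactSpace G] [μG.Regular] [μH.Regular] in
/-- Pointwise bound from below: if `f = 1` on `h L` for a compact `L ⊆ K` and `0 ≤ f`, then
`μ_K L ≤ ofReal (∫_K f(hk) dμ_K)`. [folklore] -/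
lemma measure_le_ofReal_integral_comp_mul {f : G → ℝ} (hf : Continuous f) (h0 : ∀ x, 0 ≤ f x)
    (h : H) {L : Set K} (hL : IsCompact L)
    (hf1 : ∀ k ∈ L, f ((h : G) * k) = 1) :
    μK L ≤ ENNReal.ofReal (∫ k : K, f ((h : G) * k) ∂μK) := by
  haveI : CompactSpace K := isCompact_iff_compactSpace.mp hK
  rw [ofReal_integral_eq_lintegral_ofReal
    (integrable_of_continuous_of_compactSpace (f := fun k : K => f ((h : G) * k))
      (hf.comp (continuous_coe_mul_coe h)))
    (Filter.Eventually.of_forall fun k => h0 _), ← lintegral_indicator_one hL.measurableSet]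
  refine lintegral_mono fun k => ?_
  by_cases hk : k ∈ L
  · simp [hk, hf1 k hk]
  · simp [hk]

include hH hK hC0 hC in
omit [μG.Regular] in
/-- **Open sets, upper bound**: `∫⁻_H μ_K{k : hk ∈ U} dμ_H ≤ C⁻¹ μ_G(U)` for `U` open — the
τ-smoothness step: the slice measure is the (uncountable, directed) supremum of the continuous
functions `h ↦ ∫_K f(hk) dμ_K`, `f ∈ C_c(G)`, `0 ≤ f ≤ 1`, `supp f ⊆ U`. [folklore] -/
lemma lintegral_measure_mul_preimage_le_of_isOpen {U : Set G} (hU : IsOpen U) :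
    ∫⁻ h : H, μK ((fun k : K => (h : G) * k) ⁻¹' U) ∂μH ≤ ENNReal.ofReal C⁻¹ * μG U := by
  haveI : CompactSpace K := isCompact_iff_compactSpace.mp hK
  -- index set of test functions
  let ι := {f : C_c(G, ℝ) // (∀ x, 0 ≤ f x) ∧ (∀ x, f x ≤ 1) ∧ Function.support f ⊆ U}
  haveI : Nonempty ι := ⟨⟨0, fun _ => le_rfl, fun _ => zero_le_one, by simp⟩⟩
  let g : ι → H → ℝ≥0∞ := fun f h => ENNReal.ofReal (∫ k : K, f.1 ((h : G) * k) ∂μK)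
  have hg : ∀ f : ι, LowerSemicontinuous (g f) := fun f =>
    (ENNReal.continuous_ofReal.comp ((continuous_integral_comp_mul_right μK
      (map_continuous f.1)).comp continuous_subtype_val)).lowerSemicontinuous
  have hdir : Directed (· ≤ ·) g := by
    intro f₁ f₂
    refine ⟨⟨f₁.1 ⊔ f₂.1, fun x => (f₁.2.1 x).trans (by simp), fun x => by
      simpa using ⟨f₁.2.2.1 x, f₂.2.2.1 x⟩, fun x hx => ?_⟩, ?_, ?_⟩
    · by_contra hxU
      have h1 : f₁.1 x = 0 := Function.notMem_support.mp fun h => hxU (f₁.2.2.2 h)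
      have h2 : f₂.1 x = 0 := Function.notMem_support.mp fun h => hxU (f₂.2.2.2 h)
      exact hx (by simp [h1, h2])
    · intro h
      exact ENNReal.ofReal_le_ofReal (integral_mono
        (integrable_of_continuous_of_compactSpace ((map_continuous f₁.1).comp
          (continuous_coe_mul_coe h)))
        (integrable_of_continuous_of_compactSpace ((map_continuous (f₁.1 ⊔ f₂.1)).comp
          (continuous_coe_mul_coe h)))
        fun k => by simp)
    · intro h
      exact ENNReal.ofReal_le_ofReal (integral_mono
        (integrable_of_continuous_of_compactSpace ((map_continuous f₂.1).comp
          (continuous_coe_mul_coe h)))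
        (integrable_of_continuous_of_compactSpace ((map_continuous (f₁.1 ⊔ f₂.1)).comp
          (continuous_coe_mul_coe h)))
        fun k => by simp)
  have hle : ∀ h : H, μK ((fun k : K => (h : G) * k) ⁻¹' U) ≤ ⨆ f, g f h := by
    intro h
    rw [(hU.preimage (continuous_coe_mul_coe h)).measure_eq_iSup_isCompact]
    refine iSup_le fun L => iSup_le fun hLV => iSup_le fun hL => ?_
    obtain ⟨f, hf1, hfc, hfU, hf01⟩ := exists_continuousMap_one_of_isCompact_subset_isOpen
      (hL.image (continuous_coe_mul_coe h)) hU (image_subset_iff.mpr hLV)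
    let F : ι := ⟨⟨f, hfc⟩, fun x => (hf01 x).1, fun x => (hf01 x).2,
      (subset_tsupport _).trans hfU⟩
    refine le_iSup_of_le F ?_
    exact measure_le_ofReal_integral_comp_mul hK μK (map_continuous f) (fun x => (hf01 x).1) h hL
      (fun k hk => hf1 (mem_image_of_mem _ hk))
  calc ∫⁻ h : H, μK ((fun k : K => (h : G) * k) ⁻¹' U) ∂μH
      ≤ ⨆ f, ∫⁻ h, g f h ∂μH :=
        lintegral_le_iSup_lintegral_of_directed_of_lowerSemicontinuous hg hdir
          (lowerSemicontinuous_measure_mul_preimage μK hU) hle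
    _ ≤ ENNReal.ofReal C⁻¹ * μG U := by
        refine iSup_le fun f => ?_
        simp only [g]
        rw [lintegral_ofReal_integral_comp_mul_eq hH hK μG μH μK hC0 hC (map_continuous f.1)
          f.1.hasCompactSupport f.2.1]
        gcongr
        exact lintegral_ofReal_le_measure μG f.2.2.1 hU.measurableSet f.2.2.2

include hH hK hC0 hC in
omit [μH.Regular] in
/-- **Open sets, lower bound**: `C⁻¹ μ_G(U) ≤ ∫⁻_H μ_K{k : hk ∈ U} dμ_H` for `U` open (inner
regularity of `μ_G` on `U` and Urysohn functions). [folklore] -/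
lemma mul_measure_le_lintegral_measure_mul_preimage_of_isOpen {U : Set G} (hU : IsOpen U) :
    ENNReal.ofReal C⁻¹ * μG U ≤ ∫⁻ h : H, μK ((fun k : K => (h : G) * k) ⁻¹' U) ∂μH := by
  rw [hU.measure_eq_iSup_isCompact μG]
  simp only [ENNReal.mul_iSup]
  refine iSup_le fun L => iSup_le fun hLU => iSup_le fun hL => ?_
  obtain ⟨f, hf1, hfc, hfU, hf01⟩ := exists_continuousMap_one_of_isCompact_subset_isOpen hL hU hLU
  have hsupp : Function.support f ⊆ U := (subset_tsupport _).trans hfU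
  calc ENNReal.ofReal C⁻¹ * μG L
      ≤ ENNReal.ofReal C⁻¹ * ∫⁻ g, ENNReal.ofReal (f g) ∂μG := by
        gcongr
        rw [← lintegral_indicator_one hL.measurableSet]
        refine lintegral_mono fun x => ?_
        by_cases hx : x ∈ L
        · simp [hx, hf1 hx]
        · simp [hx]
    _ = ∫⁻ h : H, ENNReal.ofReal (∫ k : K, f ((h : G) * k) ∂μK) ∂μH :=
        (lintegral_ofReal_integral_comp_mul_eq hH hK μG μH μK hC0 hC (map_continuous f) hfc
          (fun x => (hf01 x).1)).symm
    _ ≤ ∫⁻ h : H, μK ((fun k : K => (h : G) * k) ⁻¹' U) ∂μH :=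
        lintegral_mono fun h => ofReal_integral_comp_mul_le hK μK (map_continuous f)
          (fun x => (hf01 x).1) (fun x => (hf01 x).2) hU hsupp h

include hH hK hC0 hC in
/-- **Open sets**: `∫⁻_H μ_K{k : hk ∈ U} dμ_H = C⁻¹ μ_G(U)`. [folklore] -/
theorem lintegral_measure_mul_preimage_of_isOpen {U : Set G} (hU : IsOpen U) :
    ∫⁻ h : H, μK ((fun k : K => (h : G) * k) ⁻¹' U) ∂μH = ENNReal.ofReal C⁻¹ * μG U :=
  le_antisymm (lintegral_measure_mul_preimage_le_of_isOpen hH hK μG μH μK hC0 hC hU)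
    (mul_measure_le_lintegral_measure_mul_preimage_of_isOpen hH hK μG μH μK hC0 hC hU)

include hH hK hC0 hC in
/-- **Compact sets**: `∫⁻_H μ_K{k : hk ∈ L} dμ_H = C⁻¹ μ_G(L)` (from the open case applied to an
open `U ⊇ L` of finite measure and to `U ∖ L`). [folklore] -/
theorem lintegral_measure_mul_preimage_of_isCompact {L : Set G} (hL : IsCompact L) :
    ∫⁻ h : H, μK ((fun k : K => (h : G) * k) ⁻¹' L) ∂μH = ENNReal.ofReal C⁻¹ * μG L := by
  haveI : CompactSpace K := isCompact_iff_compactSpace.mp hK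
  obtain ⟨U, hLU, hU, hμU⟩ := (L : Set G).exists_isOpen_lt_of_lt (μG L + 1)
    (ENNReal.lt_add_right hL.measure_lt_top.ne one_ne_zero)
  have hUfin : μG U ≠ ∞ := hμU.ne_top
  have hdo : IsOpen (U \ L) := hU.sdiff hL.isClosed
  have hm : ∀ h : H, Measurable fun k : K => (h : G) * (k : G) := fun h =>
    (continuous_coe_mul_coe h).measurable
  have hadd : ∀ h : H, μK ((fun k : K => (h : G) * k) ⁻¹' U) =
      μK ((fun k : K => (h : G) * k) ⁻¹' L) + μK ((fun k : K => (h : G) * k) ⁻¹' (U \ L)) := by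
    intro h
    rw [← measure_union (disjoint_sdiff_right.preimage _) (hdo.measurableSet.preimage (hm h)),
      ← preimage_union, Set.union_sdiff_cancel hLU]
  have hint : ∫⁻ h : H, μK ((fun k : K => (h : G) * k) ⁻¹' U) ∂μH =
      ∫⁻ h : H, μK ((fun k : K => (h : G) * k) ⁻¹' L) ∂μH +
        ∫⁻ h : H, μK ((fun k : K => (h : G) * k) ⁻¹' (U \ L)) ∂μH := by
    simp_rw [hadd]
    exact lintegral_add_left (measurable_measure_mul_preimage μK hL.measurableSet) _
  rw [lintegral_measure_mul_preimage_of_isOpen hH hK μG μH μK hC0 hC hU,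
    lintegral_measure_mul_preimage_of_isOpen hH hK μG μH μK hC0 hC hdo] at hint
  have hGU : μG U = μG L + μG (U \ L) := by
    rw [← measure_union disjoint_sdiff_right hdo.measurableSet, Set.union_sdiff_cancel hLU]
  rw [hGU, mul_add] at hint
  have hfin : ENNReal.ofReal C⁻¹ * μG (U \ L) ≠ ∞ :=
    ENNReal.mul_ne_top ENNReal.ofReal_ne_top
      (ne_top_of_le_ne_top hUfin (measure_mono Set.sdiff_subset))
  exact ((ENNReal.add_left_inj hfin).mp hint).symm

include hH hK hC0 hC in
/-- **Sets of finite Haar measure**: `∫⁻_H μ_K{k : hk ∈ A} dμ_H = C⁻¹ μ_G(A)` for Borel `A` with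
`μ_G(A) < ∞` (squeeze between compact subsets and open supersets). [folklore] -/
theorem lintegral_measure_mul_preimage_of_ne_top {A : Set G} (hA : MeasurableSet A)
    (hfin : μG A ≠ ∞) :
    ∫⁻ h : H, μK ((fun k : K => (h : G) * k) ⁻¹' A) ∂μH = ENNReal.ofReal C⁻¹ * μG A := by
  have hc0 : ENNReal.ofReal C⁻¹ ≠ 0 := by simpa using hC0
  apply le_antisymm
  · calc ∫⁻ h : H, μK ((fun k : K => (h : G) * k) ⁻¹' A) ∂μH
        ≤ ⨅ (U : Set G) (_ : A ⊆ U) (_ : IsOpen U),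
            ∫⁻ h : H, μK ((fun k : K => (h : G) * k) ⁻¹' U) ∂μH :=
          le_iInf fun U => le_iInf fun hAU => le_iInf fun _ =>
            lintegral_mono fun h => measure_mono (preimage_mono hAU)
      _ = ⨅ (U : Set G) (_ : A ⊆ U) (_ : IsOpen U), ENNReal.ofReal C⁻¹ * μG U :=
          iInf_congr fun U => iInf_congr fun _ => iInf_congr fun hU =>
            lintegral_measure_mul_preimage_of_isOpen hH hK μG μH μK hC0 hC hU
      _ = ENNReal.ofReal C⁻¹ * μG A := by
          rw [A.measure_eq_iInf_isOpen μG]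
          simp only [ENNReal.mul_iInf_of_ne hc0 ENNReal.ofReal_ne_top]
  · rw [hA.measure_eq_iSup_isCompact_of_ne_top hfin]
    simp only [ENNReal.mul_iSup]
    exact iSup_le fun L => iSup_le fun hLA => iSup_le fun hL =>
      (lintegral_measure_mul_preimage_of_isCompact hH hK μG μH μK hC0 hC hL).symm.le.trans
        (lintegral_mono fun h => measure_mono (preimage_mono hLA))

include hH hK hC0 hC in
/-- The same identity solved for `μ_G`: `μ_G(A) = C ∫⁻_H μ_K{k : hk ∈ A} dμ_H` for Borel `A` of
finite Haar measure; in particular `μ_G`-null sets have null slices for `μ_H`-a.e. `h`. [folklore] -/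
theorem measure_eq_mul_lintegral_measure_mul_preimage {A : Set G} (hA : MeasurableSet A)
    (hfin : μG A ≠ ∞) :
    μG A = ENNReal.ofReal C * ∫⁻ h : H, μK ((fun k : K => (h : G) * k) ⁻¹' A) ∂μH := by
  rw [lintegral_measure_mul_preimage_of_ne_top hH hK μG μH μK hC0 hC hA hfin, ← mul_assoc,
    ← ENNReal.ofReal_mul hC0.le, mul_inv_cancel₀ hC0.ne', ENNReal.ofReal_one, one_mul]

end OpenCompact

end Literature.NumberTheory.Automorphic.HaarHK
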